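import Mathlib.Analysis.Calculus.ContDiff.Operations
import Mathlib.Analysis.Calculus.FDeriv.Mul
import Mathlib.Analysis.Calculus.Deriv.Comp
import Mathlib.Analysis.Normed.Operator.Bilinear
import HarnessLib

/-!
# Holonomic approximation: affine Taylor sections and transverse interpolation

Topic `Literature/Topology/Immersions`; first analytic ingredients of the **holonomic
approximation theorem over a cube** (Eliashberg–Mishachev, *Holonomic approximation and
Gromov's h-principle* (2001), Thm. 1.3.1 and the Inductional Lemma 1.3.2; book
*Introduction to the h-principle* (2002), Thm. 3.1.1), the analytic heart of the
Gromov–Eliashberg–Mishachev route to Phillips' submersion theorem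
(`Literature.Topology.Immersions.Phillips1967_exists_isLocalDiffeomorph_of_isParallelizable`).
A section of the `1`-jet bundle `J¹(E, F)` over an open set is a pair of continuous maps
`F₀ : E → F` (values) and `F₁ : E → (E →L F)` (candidate derivatives); it is *holonomic* where
`F₁ = D F₀`. Two devices of the proof of the Inductional Lemma are recorded here, for maps
between real normed spaces:

* `Literature.Topology.Immersions.taylorAffine F₀ F₁ c` — the **affine Taylor section** at `c`,
  `x ↦ F₀ c + F₁ c (x - c)`: a genuine (holonomic) map whose `1`-jet at `c` is `(F₀ c, F₁ c)`
  ("any section is holonomic over any point", EM 2001 §1.1); its derivative is the constant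
  `F₁ c` (`hasFDerivAt_taylorAffine`), and its `1`-jet is uniformly close to `(F₀, F₁)` on small
  balls around points of a compact set (`taylorAffine_approx`: uniform continuity).
* `Literature.Topology.Immersions.transverseInterp θ ℓ f g` — the **transverse interpolation**
  `x ↦ f x + θ (ℓ x) • (g x - f x)` of two maps by a cut-off `θ` of a linear coordinate `ℓ`
  (EM 2001, proof of Lemma 1.3.2: `Gⁱ = Fⁱ⁺¹` on the top half `{xₙ ≥ δ/2}`, `= Fⁱ⁻¹` on the
  bottom half): its derivative is
  `D f + θ(ℓ x) • (D g - D f) + θ'(ℓ x) ℓ ⊗ (g x - f x)` (`hasFDerivAt_transverseInterp`), whence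
  the key estimate `norm_fderiv_transverseInterp_sub_le`: the `1`-jet of the interpolation is
  as close to `(F₀, F₁)` as those of `f` and `g`, up to the **gluing error**
  `|θ'| ‖ℓ‖ ‖g x - f x‖` — small when `f` and `g` are `C⁰`-close compared with the fixed slope
  `|θ'| ~ 1/δ` of the cut-off. This is why the interpolation is performed in a direction
  transverse to the cube, at a fixed scale `δ`, between consecutive members of a continuous
  family (whose `C⁰`-distance tends to `0`).

Everything is **proved**; the two `def`s are explicit formulas with unfolding lemmas.

## References

* Y. Eliashberg, N. Mishachev, *Holonomic approximation and Gromov's h-principle*,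
  arXiv:math/0101196 (2001), §1.1, Thm. 1.3.1, Lemma 1.3.2. [EliashbergMishachev2001]
  (held: `paper:arxiv-math_0101196`)
* Y. Eliashberg, N. Mishachev, *Introduction to the h-principle*, GSM 48, AMS (2002), Ch. 3,
  Thm. 3.1.1. [EliashbergMishachev2002]
-/

open Set Function Filter Metric
open scoped Topology ContDiff

noncomputable section

namespace Literature.Topology.Immersions

variable {E F : Type*} [NormedAddCommGroup E] [NormedSpace ℝ E] [NormedAddCommGroup F]
  [NormedSpace ℝ F]

/-! ### Affine Taylor sections -/

/-- The **affine Taylor section** of the `1`-jet section `(F₀, F₁)` at the point `c`: the affine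
map `x ↦ F₀ c + F₁ c (x - c)`, the unique affine map with `1`-jet `(F₀ c, F₁ c)` at `c`
(Eliashberg–Mishachev 2001, §1.1: "any section is holonomic over any point … take the Taylor
polynomial map"). [cite: EliashbergMishachev2001, §1.1] -/
def taylorAffine (F₀ : E → F) (F₁ : E → E →L[ℝ] F) (c : E) (x : E) : F :=
  F₀ c + F₁ c (x - c)

/-- Unfolding lemma for `taylorAffine`. [cite: EliashbergMishachev2001, §1.1] -/
theorem taylorAffine_apply (F₀ : E → F) (F₁ : E → E →L[ℝ] F) (c x : E) :
    taylorAffine F₀ F₁ c x = F₀ c + F₁ c (x - c) :=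
  rfl

/-- The affine Taylor section takes the value `F₀ c` at `c`. [folklore] -/
@[simp]
theorem taylorAffine_self (F₀ : E → F) (F₁ : E → E →L[ℝ] F) (c : E) :
    taylorAffine F₀ F₁ c c = F₀ c := by
  simp [taylorAffine]

/-- The affine Taylor section at `c` has derivative `F₁ c` at every point. [folklore] -/
theorem hasFDerivAt_taylorAffine (F₀ : E → F) (F₁ : E → E →L[ℝ] F) (c x : E) :
    HasFDerivAt (taylorAffine F₀ F₁ c) (F₁ c) x := by
  have h1 : HasFDerivAt (fun x : E => x - c) (ContinuousLinearMap.id ℝ E) x :=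
    (hasFDerivAt_id x).sub_const c
  have h2 : HasFDerivAt (fun x : E => F₁ c (x - c)) ((F₁ c).comp (ContinuousLinearMap.id ℝ E)) x :=
    (F₁ c).hasFDerivAt.comp x h1
  rw [ContinuousLinearMap.comp_id] at h2
  exact h2.const_add (F₀ c)

/-- The derivative of the affine Taylor section is the constant `F₁ c`. [folklore] -/
theorem fderiv_taylorAffine (F₀ : E → F) (F₁ : E → E →L[ℝ] F) (c x : E) :
    fderiv ℝ (taylorAffine F₀ F₁ c) x = F₁ c :=
  (hasFDerivAt_taylorAffine F₀ F₁ c x).fderiv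

/-- The affine Taylor section is `C^∞` (an affine map). [folklore] -/
theorem contDiff_taylorAffine (F₀ : E → F) (F₁ : E → E →L[ℝ] F) (c : E) {k : WithTop ℕ∞} :
    ContDiff ℝ k (taylorAffine F₀ F₁ c) := by
  unfold taylorAffine
  fun_prop

/-- **Joint continuity of the Taylor family**: if `F₀` and `F₁` are continuous on `O`, then
`(c, x) ↦ taylorAffine F₀ F₁ c x` is continuous on `O ×ˢ univ`. This is the continuity in the
parameter which makes consecutive members of the family `C⁰`-close (EM 2001, proof of
Lemma 1.3.2, "`σ(N) → 0`"). [cite: EliashbergMishachev2001, Lemma 1.3.2] -/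
theorem continuousOn_taylorAffine {F₀ : E → F} {F₁ : E → E →L[ℝ] F} {O : Set E}
    (h₀ : ContinuousOn F₀ O) (h₁ : ContinuousOn F₁ O) :
    ContinuousOn (fun q : E × E => taylorAffine F₀ F₁ q.1 q.2) (O ×ˢ univ) := by
  have h₀' : ContinuousOn (fun q : E × E => F₀ q.1) (O ×ˢ univ) :=
    h₀.comp continuousOn_fst fun q hq => hq.1
  have h₁' : ContinuousOn (fun q : E × E => F₁ q.1) (O ×ˢ univ) :=
    h₁.comp continuousOn_fst fun q hq => hq.1
  have h₂ : ContinuousOn (fun q : E × E => q.2 - q.1) (O ×ˢ univ) :=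
    (continuous_snd.sub continuous_fst).continuousOn
  exact h₀'.add (h₁'.clm_apply h₂)

/-- Pointwise `1`-jet errors of the affine Taylor section: the value error at `x` is at most
`‖F₀ c - F₀ x‖ + ‖F₁ c‖ ‖x - c‖`, the derivative error is `‖F₁ c - F₁ x‖`. [folklore] -/
theorem norm_taylorAffine_sub_le (F₀ : E → F) (F₁ : E → E →L[ℝ] F) (c x : E) :
    ‖taylorAffine F₀ F₁ c x - F₀ x‖ ≤ ‖F₀ c - F₀ x‖ + ‖F₁ c‖ * ‖x - c‖ := by
  rw [taylorAffine_apply, add_sub_right_comm]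
  exact (norm_add_le _ _).trans (add_le_add le_rfl ((F₁ c).le_opNorm _))

/-- **Uniform approximation by affine Taylor sections near a compact set** (EM 2001, base of the
induction in the proof of Thm. 1.3.1). If `F₀`, `F₁` are continuous on an open set `O`
containing the compact set `K`, then for every `ε > 0` there is `δ > 0` such that
`closedBall c δ ⊆ O` for all `c ∈ K` and the affine Taylor section at any `c ∈ K` has `1`-jet
`ε`-close to `(F₀, F₁)` on `ball c δ`:
`‖taylorAffine c x - F₀ x‖ < ε` and `‖F₁ c - F₁ x‖ < ε` (its derivative being `F₁ c`).
Proof: uniform continuity of `F₀`, `F₁` on a compact neighbourhood of `K` inside `O` and a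
bound for `‖F₁‖` on `K`. [cite: EliashbergMishachev2001, Thm. 1.3.1 (proof, base case)] -/
theorem taylorAffine_approx [ProperSpace E] {F₀ : E → F} {F₁ : E → E →L[ℝ] F} {O K : Set E}
    (hO : IsOpen O) (hK : IsCompact K) (hKO : K ⊆ O) (h₀ : ContinuousOn F₀ O)
    (h₁ : ContinuousOn F₁ O) {ε : ℝ} (hε : 0 < ε) :
    ∃ δ > 0, (∀ c ∈ K, closedBall c δ ⊆ O) ∧ ∀ c ∈ K, ∀ x ∈ ball c δ,
      ‖taylorAffine F₀ F₁ c x - F₀ x‖ < ε ∧ ‖F₁ c - F₁ x‖ < ε := by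
  -- a compact neighbourhood `K' = cthickening r K ⊆ O`
  obtain ⟨r, hr, hrO⟩ := hK.exists_cthickening_subset_open hO hKO
  set K' := cthickening r K with hK'
  have hK'c : IsCompact K' := hK.cthickening
  have hKK' : ∀ c ∈ K, closedBall c r ⊆ K' := fun c hc =>
    closedBall_subset_cthickening hc r
  -- uniform continuity of `F₀`, `F₁` on `K'`
  have hu₀ := hK'c.uniformContinuousOn_of_continuous (h₀.mono hrO)
  have hu₁ := hK'c.uniformContinuousOn_of_continuous (h₁.mono hrO)
  rw [Metric.uniformContinuousOn_iff] at hu₀ hu₁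
  obtain ⟨δ₀, hδ₀, hδ₀'⟩ := hu₀ (ε / 2) (half_pos hε)
  obtain ⟨δ₁, hδ₁, hδ₁'⟩ := hu₁ ε hε
  -- a bound for `‖F₁‖` on `K`
  obtain ⟨B, hB0, hB⟩ :=
    (hK.image_of_continuousOn (h₁.mono hKO)).isBounded.exists_pos_norm_le
  have hB' : ∀ c ∈ K, ‖F₁ c‖ ≤ B := fun c hc => hB _ (mem_image_of_mem _ hc)
  -- the radius
  set ρ : ℝ := min (min r δ₀) (min δ₁ (ε / (2 * (B + 1)))) with hρ
  have hρr : ρ ≤ r := (min_le_left _ _).trans (min_le_left _ _)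
  have hρ₀ : ρ ≤ δ₀ := (min_le_left _ _).trans (min_le_right _ _)
  have hρ₁ : ρ ≤ δ₁ := (min_le_right _ _).trans (min_le_left _ _)
  have hρε : ρ ≤ ε / (2 * (B + 1)) := (min_le_right _ _).trans (min_le_right _ _)
  refine ⟨ρ, ?_, ?_, ?_⟩
  · refine lt_min (lt_min hr hδ₀) (lt_min hδ₁ ?_)
    positivity
  · intro c hc
    exact ((closedBall_subset_closedBall hρr).trans (hKK' c hc)).trans hrO
  · intro c hc x hx
    rw [mem_ball] at hx
    have hxr : x ∈ K' := hKK' c hc (mem_closedBall.2 (hx.le.trans hρr))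
    have hcK' : c ∈ K' := hKK' c hc (mem_closedBall_self hr.le)
    have hd₀ : dist c x < δ₀ := by
      rw [dist_comm]
      exact hx.trans_le hρ₀
    have hd₁ : dist c x < δ₁ := by
      rw [dist_comm]
      exact hx.trans_le hρ₁
    have hxε : ‖x - c‖ < ε / (2 * (B + 1)) := by
      rw [← dist_eq_norm]
      exact hx.trans_le hρε
    have hhalf : (B + 1) * (ε / (2 * (B + 1))) = ε / 2 := by
      field_simp
    constructor
    · calc ‖taylorAffine F₀ F₁ c x - F₀ x‖
          ≤ ‖F₀ c - F₀ x‖ + ‖F₁ c‖ * ‖x - c‖ := norm_taylorAffine_sub_le F₀ F₁ c x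
        _ < ε / 2 + (B + 1) * (ε / (2 * (B + 1))) := by
            gcongr ?_ + ?_
            · rw [← dist_eq_norm]
              exact hδ₀' c hcK' x hxr hd₀
            · calc ‖F₁ c‖ * ‖x - c‖ ≤ (B + 1) * ‖x - c‖ := by
                    gcongr
                    linarith [hB' c hc]
                _ < (B + 1) * (ε / (2 * (B + 1))) := by
                    gcongr
        _ = ε := by rw [hhalf]; ring
    · rw [← dist_eq_norm]
      exact hδ₁' c hcK' x hxr hd₁

/-! ### Transverse interpolation -/

/-- The **transverse interpolation** of `f` and `g` by the cut-off `θ` of the linear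
coordinate `ℓ`: `x ↦ f x + θ (ℓ x) • (g x - f x)`; equal to `f` where `θ ∘ ℓ = 0` and to `g`
where `θ ∘ ℓ = 1` (EM 2001, proof of Lemma 1.3.2: the sections `Gⁱ` interpolating between
`Fⁱ⁻¹` on `{xₙ ≤ -δ/2}` and `Fⁱ⁺¹` on `{xₙ ≥ δ/2}`). [cite: EliashbergMishachev2001, Lemma 1.3.2] -/
def transverseInterp (θ : ℝ → ℝ) (ℓ : E →L[ℝ] ℝ) (f g : E → F) (x : E) : F :=
  f x + θ (ℓ x) • (g x - f x)

/-- Unfolding lemma for `transverseInterp`. [cite: EliashbergMishachev2001, Lemma 1.3.2] -/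
theorem transverseInterp_apply (θ : ℝ → ℝ) (ℓ : E →L[ℝ] ℝ) (f g : E → F) (x : E) :
    transverseInterp θ ℓ f g x = f x + θ (ℓ x) • (g x - f x) :=
  rfl

/-- Where the cut-off vanishes the interpolation is `f`. [folklore] -/
theorem transverseInterp_of_eq_zero {θ : ℝ → ℝ} {ℓ : E →L[ℝ] ℝ} {f g : E → F} {x : E}
    (h : θ (ℓ x) = 0) : transverseInterp θ ℓ f g x = f x := by
  simp [transverseInterp, h]

/-- Where the cut-off is `1` the interpolation is `g`. [folklore] -/
theorem transverseInterp_of_eq_one {θ : ℝ → ℝ} {ℓ : E →L[ℝ] ℝ} {f g : E → F} {x : E}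
    (h : θ (ℓ x) = 1) : transverseInterp θ ℓ f g x = g x := by
  simp [transverseInterp, h]

/-- Where `f = g` the interpolation is `f`, whatever the cut-off. [folklore] -/
theorem transverseInterp_of_eq {θ : ℝ → ℝ} {ℓ : E →L[ℝ] ℝ} {f g : E → F} {x : E}
    (h : f x = g x) : transverseInterp θ ℓ f g x = f x := by
  simp [transverseInterp, h]

/-- The interpolation as a convex combination: `(1 - θ) • f + θ • g`. [folklore] -/
theorem transverseInterp_eq_convex (θ : ℝ → ℝ) (ℓ : E →L[ℝ] ℝ) (f g : E → F) (x : E) :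
    transverseInterp θ ℓ f g x = (1 - θ (ℓ x)) • f x + θ (ℓ x) • g x := by
  simp only [transverseInterp, smul_sub, sub_smul, one_smul]
  abel

/-- The transverse interpolation of `C^k` maps by a `C^k` cut-off is `C^k`. [folklore] -/
theorem contDiff_transverseInterp {θ : ℝ → ℝ} {ℓ : E →L[ℝ] ℝ} {f g : E → F} {k : WithTop ℕ∞}
    (hθ : ContDiff ℝ k θ) (hf : ContDiff ℝ k f) (hg : ContDiff ℝ k g) :
    ContDiff ℝ k (transverseInterp θ ℓ f g) := by
  unfold transverseInterp
  exact hf.add ((hθ.comp ℓ.contDiff).smul (hg.sub hf))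

/-- **Derivative of the transverse interpolation**:
`D(f + θ(ℓ ·) • (g - f))_x = D f_x + θ (ℓ x) • (D g_x - D f_x) + (θ' (ℓ x) • ℓ) ⊗ (g x - f x)`
(product and chain rules). [cite: EliashbergMishachev2001, Lemma 1.3.2] -/
theorem hasFDerivAt_transverseInterp {θ : ℝ → ℝ} {θ' : ℝ} {ℓ : E →L[ℝ] ℝ} {f g : E → F}
    {f' g' : E →L[ℝ] F} {x : E} (hθ : HasDerivAt θ θ' (ℓ x)) (hf : HasFDerivAt f f' x)
    (hg : HasFDerivAt g g' x) :
    HasFDerivAt (transverseInterp θ ℓ f g)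
      (f' + (θ (ℓ x) • (g' - f') + (θ' • ℓ).smulRight (g x - f x))) x := by
  have hc : HasFDerivAt (fun y => θ (ℓ y)) (θ' • ℓ) x := hθ.comp_hasFDerivAt x ℓ.hasFDerivAt
  have hs := hc.smul (hg.sub hf)
  exact hf.add hs

/-- The gluing term has norm `|θ'| ‖ℓ‖ ‖g x - f x‖`. [folklore] -/
theorem norm_smulRight_smul (θ' : ℝ) (ℓ : E →L[ℝ] ℝ) (v : F) :
    ‖(θ' • ℓ).smulRight v‖ = |θ'| * ‖ℓ‖ * ‖v‖ := by
  rw [ContinuousLinearMap.norm_smulRight_apply, norm_smul, Real.norm_eq_abs]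

/-- **The key estimate for the transverse interpolation** (EM 2001, proof of Lemma 1.3.2). If
`0 ≤ θ (ℓ x) ≤ 1`, the derivative of the interpolation differs from any target `L` by at most
the convex combination of the errors of `D f_x` and `D g_x` plus the gluing error
`|θ'| ‖ℓ‖ ‖g x - f x‖`:
`‖D f_x + θ • (D g_x - D f_x) + (θ' • ℓ) ⊗ (g x - f x) - L‖
  ≤ (1 - θ) ‖D f_x - L‖ + θ ‖D g_x - L‖ + |θ'| ‖ℓ‖ ‖g x - f x‖`.
[cite: EliashbergMishachev2001, Lemma 1.3.2] -/
theorem norm_fderiv_transverseInterp_sub_le {θ₀ θ' : ℝ} (h0 : 0 ≤ θ₀) (h1 : θ₀ ≤ 1)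
    (ℓ : E →L[ℝ] ℝ) (f' g' L : E →L[ℝ] F) (v : F) :
    ‖f' + (θ₀ • (g' - f') + (θ' • ℓ).smulRight v) - L‖ ≤
      (1 - θ₀) * ‖f' - L‖ + θ₀ * ‖g' - L‖ + |θ'| * ‖ℓ‖ * ‖v‖ := by
  have hsplit : f' + (θ₀ • (g' - f') + (θ' • ℓ).smulRight v) - L =
      ((1 - θ₀) • (f' - L) + θ₀ • (g' - L)) + (θ' • ℓ).smulRight v := by
    simp only [smul_sub, sub_smul, one_smul]
    abel
  rw [hsplit]
  calc ‖((1 - θ₀) • (f' - L) + θ₀ • (g' - L)) + (θ' • ℓ).smulRight v‖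
      ≤ ‖(1 - θ₀) • (f' - L) + θ₀ • (g' - L)‖ + ‖(θ' • ℓ).smulRight v‖ := norm_add_le _ _
    _ ≤ (‖(1 - θ₀) • (f' - L)‖ + ‖θ₀ • (g' - L)‖) + ‖(θ' • ℓ).smulRight v‖ := by
        gcongr; exact norm_add_le _ _
    _ = (1 - θ₀) * ‖f' - L‖ + θ₀ * ‖g' - L‖ + |θ'| * ‖ℓ‖ * ‖v‖ := by
        rw [norm_smul, norm_smul, Real.norm_of_nonneg (sub_nonneg.2 h1), Real.norm_of_nonneg h0,
          norm_smulRight_smul]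

/-- **Value estimate for the transverse interpolation**: a convex combination is as close to any
target as the worse of its ends: `‖interp - y‖ ≤ (1 - θ) ‖f x - y‖ + θ ‖g x - y‖`.
[folklore] -/
theorem norm_transverseInterp_sub_le {θ : ℝ → ℝ} {ℓ : E →L[ℝ] ℝ} {f g : E → F} {x : E}
    (h0 : 0 ≤ θ (ℓ x)) (h1 : θ (ℓ x) ≤ 1) (y : F) :
    ‖transverseInterp θ ℓ f g x - y‖ ≤
      (1 - θ (ℓ x)) * ‖f x - y‖ + θ (ℓ x) * ‖g x - y‖ := by
  rw [transverseInterp_eq_convex]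
  have hsplit : (1 - θ (ℓ x)) • f x + θ (ℓ x) • g x - y =
      (1 - θ (ℓ x)) • (f x - y) + θ (ℓ x) • (g x - y) := by
    simp only [smul_sub, sub_smul, one_smul]
    abel
  rw [hsplit]
  calc ‖(1 - θ (ℓ x)) • (f x - y) + θ (ℓ x) • (g x - y)‖
      ≤ ‖(1 - θ (ℓ x)) • (f x - y)‖ + ‖θ (ℓ x) • (g x - y)‖ := norm_add_le _ _
    _ = (1 - θ (ℓ x)) * ‖f x - y‖ + θ (ℓ x) * ‖g x - y‖ := by
        rw [norm_smul, norm_smul, Real.norm_of_nonneg (sub_nonneg.2 h1), Real.norm_of_nonneg h0]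

end Literature.Topology.Immersions
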